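/-
Origin: expansion seat `prover-pub-hodgecm-mc-binder-1-g14-0`, handover #R84 2026-08-20T16:54:41Z md5 13eb6614b916 (74 l.; NEW additive MODEL leaf (re-cut 4-ary), twin of axioms-1 `HLiuOfCommonReflex`: E-level composition `hLiu_of_smallLevel ∘ hsmall_of_commonReflexUnion`; imports HLiuOfSmallLevel + #R83 — NEITHER is in glue-1 scope56 block (47 files = EndStateMeetOG forward cone), so no cross-kit rowdep; drops with #R83; NAME LIST: HodgeCM.Model.hLiu_of_commonReflexUnion) (`HOME/mc/pub-hodgecm-mc-binder-1-g14/stage56/HodgeCM/Model/HLiuOfCommonReflexUnion.lean`, md5 13eb6614b916, 74 lines);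
landed by the second packager p2 gen 10 (p2-g10) in gate run 56 as `HodgeCM/Model/HLiuOfCommonReflexUnion.lean` (packager comment re-wording per the RUN-32 precedent (gate audit (5) rejects the proof-placeholder tokens s-o-r-r-y / a-d-m-i-t anywhere in a source, comments included): 1 occurrence(s) inside COMMENTS re-spelt `proof-hole` / `adm-token`; no Lean code byte touched).
-/
/-
Copyright (c) 2026 the pub-hodgecm formalisation cell (harness21).  New file, not vendored.
Origin: session prover-pub-hodgecm-mc-binder-1-g14-0 (unit pub-hodgecm-mc-binder-1-g14, BINDER PROVER gen 14 of lineage mc-binder-1;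
content lane (J-Liu-Θ) of BINDER-TRIAGE §58.2), 2026-08-20.  Intended final place: `HodgeCM/Model/HLiuOfCommonReflexUnion.lean`
(NEW additive MODEL leaf beside `Model/HLiuOfCommonReflex.lean` (RUN 39, axioms-1-g12); imports `HodgeCM.Model.HLiuOfSmallLevel` (RUN 37)
and `HodgeCM.Model.HsmallOfCommonReflexUnion` (this kit); nothing imports it; install after both; drop alone on bounce).
-/
import Summits.HodgeConjecture.HodgeCM.Model.HLiuOfSmallLevel
import Summits.HodgeConjecture.HodgeCM.Model.HsmallOfCommonReflexUnion

set_option autoImplicit false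

/-!
# E's binder `hLiu` from the UNION form of the common-reflex factorisation

`HodgeCM.Model.hLiu_of_commonReflexUnion` — for THE END STATE's theta model
`R := thetaModelOf hHD hI h₁ h₃ h (embOf …) (coverOf … hA) (wmOfInput W) (thetaOf …) (d12Of μ) (d34Of μ)`: the row-9 CONCLUSION of
`Model.hLiu_of_smallLevel` (all levels `Γ`; E's former binder `hLiu`, text verbatim) from Riemann's fullness `hR` and the PER-CLASS
(union-form) common-reflex factorisation hypothesis `hΘ∪` of `Model.hsmall_of_commonReflexUnion` — by the literal composition
`hLiu_of_smallLevel … (hsmall_of_commonReflexUnion … hR R hΘ∪)`, exactly as `Model.hLiu_of_commonReflexInput` composes the single-`D`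
form.  KERNEL CONTENT: none beyond its two imports; its point is that the composition TYPECHECKS at E's model term, so that a row-9
binder of the union shape `∀ i, ∃ Γ₀, ∀ Γ ≤ Γ₀, Theta V c i Γ ⊆ span (⋃ D : CommonReflexInput c.K (c.Ψ i) c.σ, D.surfaceClasses V Γ)` —
the shape the (J-Liu-Θ) junction delivers ([Liu21] Thm. 4.18: one `A_μ` per character; scope memo
`HOME/mc/pub-hodgecm-mc-binder-1-g14/JLIU-THETA-SCOPE.md` §3) — feeds E's row 9 with nothing in between.  Whether E's text of record
trades `hΘ` for `hΘ∪` is a record matter (axioms-1 custody, lead); this file asserts nothing and changes no record.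

0 `proof-hole`, 0 `axiom`; expected `#print axioms` ⊆ {propext, Classical.choice, Quot.sound}.
-/

noncomputable section

namespace HodgeCM

namespace Model

open HodgeCM.Universe (ThetaModel)
open Literature.AlgebraicGeometry.HodgeTheory
open Literature.NumberTheory.Automorphic.PicardCM
open Literature.NumberTheory.Transcendental (Arapura2012_Cor_15_4_6)
open HodgeCM.CMTypeOps (inflate)
open HodgeCM.Model.ThetaSpace

variable (hHD : exists_isReal_hodgeModel) (hI : hodgePQ_independent_of_hodgeModel)
  (h₁ : BallQuotientUniformised) (h₃ : CMAbelianVarietyRealised)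

/-- **E's `hLiu` from the union form `hΘ∪`.**  The conclusion of `Model.hLiu_of_smallLevel` (all levels `Γ`; E's row-9 text) for
THE model `thetaModelOf …`, from `hR : DeligneMilne1982_Thm_6_20_full` and the per-class common-reflex factorisation hypothesis at
small level — `hLiu_of_smallLevel ∘ hsmall_of_commonReflexUnion`. [folklore] -/
theorem hLiu_of_commonReflexUnion (h : Bool) (hA : Arapura2012_Cor_15_4_6)
    (W : ∀ {L : CMField} {ι₁ : L →+* ℂ} (V : HermSpace3 L ι₁) (c : SeesawCtx L), WmInput V c.D)
    (S : ∀ {L : CMField} {ι₁ : L →+* ℂ} (V : HermSpace3 L ι₁) (c : SeesawCtx L), ThetaAdelicSide V c)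
    (μ : ∀ {L : CMField}, SeesawCtx L → Fin 4 → NumberField.InfinitePlace L → ℤ)
    (hR : DeligneMilne1982_Thm_6_20_full)
    (hΘ : ∀ {L : CMField} {ι₁ : L →+* ℂ} (V : HermSpace3 L ι₁) (c : SeesawCtx L),
      (thetaModelOf hHD hI h₁ h₃ h (embOf hHD hI h₁ h₃) (coverOf hHD hI h₁ h₃ hA) (wmOfInput W) (thetaOf _ (thetaClassInputOf _ (fun V c => thetaSpaceInputOf hHD hI h₁ h₃ S V c))) (d12Of μ) (d34Of μ)).GoodCtx ι₁ c → Module.finrank ℚ c.K = 6 →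
      ∀ i : Fin 4, ∃ Γ₀ : Level V, ∀ Γ ≤ Γ₀,
        (thetaModelOf hHD hI h₁ h₃ h (embOf hHD hI h₁ h₃) (coverOf hHD hI h₁ h₃ hA) (wmOfInput W) (thetaOf _ (thetaClassInputOf _ (fun V c => thetaSpaceInputOf hHD hI h₁ h₃ S V c))) (d12Of μ) (d34Of μ)).Theta V c i Γ ⊆
          Submodule.span ℂ (⋃ D : CommonReflexInput c.K (c.Ψ i) c.σ, D.surfaceClasses hHD hI h₁ h₃ V Γ)) :
    ∀ {L : CMField} {ι₁ : L →+* ℂ} (V : HermSpace3 L ι₁) (c : SeesawCtx L),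
      (thetaModelOf hHD hI h₁ h₃ h (embOf hHD hI h₁ h₃) (coverOf hHD hI h₁ h₃ hA) (wmOfInput W) (thetaOf _ (thetaClassInputOf _ (fun V c => thetaSpaceInputOf hHD hI h₁ h₃ S V c))) (d12Of μ) (d34Of μ)).GoodCtx ι₁ c → Module.finrank ℚ c.K = 6 →
      ∀ (i : Fin 4) (Γ : Level V), ∃ (M : CMField) (k : c.K →+* M) (σ' : M →+* ℂ), σ'.comp k = c.σ ∧
        (thetaModelOf hHD hI h₁ h₃ h (embOf hHD hI h₁ h₃) (coverOf hHD hI h₁ h₃ hA) (wmOfInput W) (thetaOf _ (thetaClassInputOf _ (fun V c => thetaSpaceInputOf hHD hI h₁ h₃ S V c))) (d12Of μ) (d34Of μ)).Theta V c i Γ ⊆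
          (picardCMUniverse hHD hI h₁ h₃).Uiso Γ M (inflate k (c.Ψ i)) σ' :=
  hLiu_of_smallLevel hHD hI h₁ h₃ h hA W S μ
    (hsmall_of_commonReflexUnion hHD hI h₁ h₃ hR
      (thetaModelOf hHD hI h₁ h₃ h (embOf hHD hI h₁ h₃) (coverOf hHD hI h₁ h₃ hA) (wmOfInput W)
        (thetaOf _ (thetaClassInputOf _ (fun V c => thetaSpaceInputOf hHD hI h₁ h₃ S V c))) (d12Of μ) (d34Of μ))
      hΘ)

end Model

end HodgeCM

end
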